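import Summits.KontsevichZagierPeriods.KontsevichZagierPeriods.Theorems.HurwitzMicroSectorsHurwitzSectorComplementStubClausenCellsAux

/-!
# `HurwitzSectorComplement` (stmt-KontsevichZagierPeriods-14341, route HurwitzMicroSectors),
# line `chebyshev-level-deformation`: stub `stub_clausenCells` (S5) — the Catalan–Clausen junction

The logarithmic bottom of the Chebyshev ladder, `q = [(x,v) ∈ (0,1)², g(v)·T(v;x)]`,
`g(v) = 2/(1+v²)`, `T(v;x) = ((1−v²) − (1+v²)x)/((1−x)² + v²(1+x)²)` (value Catalan's `G`), is
congruent modulo the Kontsevich–Zagier moves to `[p₊] − [p₋]`, the two `ℚ`-rational cells of the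
unfolded Clausen arc with integrand `1/((1+v²)u)` on `p₊ = {0<v<1, 4v²/(1+v²) < u < 1}` and
`p₋ = {0<v<1, 1 < u < 4v²/(1+v²)}` (`stub_clausenCells`, the registered signature of stub S5).

Route (moves only; the chart is auxiliary file 1, `stub_clausenCells_aux1`):
* `stub_clausenCells_aux2` (registered auxiliary stub): split `q` along the null curve
  `x = c(v) = (1−v²)/(1+v²)` (rule (1): `volume_diff_cells`, one domain additivity); on each cell the
  fibrewise substitution `u = x² − 2c(v)x + 1` (`(1+v²)u = (1−x)² + v²(1+x)²`, `g T dx = −du/((1+v²)u)`)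
  is ONE change of variables (rule (2), `exists_cov`; the target's integrability is transported
  through the chart, `MeasureTheory.integrableOn_image_iff_integrableOn_abs_det_fderiv_smul`, its
  domain is semialgebraic as the image of a semialgebraic map) onto `e₁ = [E₁, 1/((1+v²)u)]`,
  `E₁ = {m(v) < u < 1}`, resp. `e₂ = [E₂, −1/((1+v²)u)]`, `E₂ = {m(v) < u < M(v)}`
  (`m = 4v²/(1+v²)²`, `M = 4v²/(1+v²)`, written polynomially);
* `ClausenCells.cancel`: the doubly covered range `A = E₁ ∩ E₂ = {m < u < min(M, 1)}` carries `f`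
  and `−f` and cancels, and what remains of `E₁`, `E₂` is `p₊.domain`, resp. `p₋.domain` with the
  opposite sign, up to the null walls `u = M(v)`, `u = 1` (rule (1)); hence `[q] ≡ [p₊] − [p₋]`.

References: M. Kontsevich, D. Zagier, *Periods* (2001), §1.2 rules (1), (2).
-/

noncomputable section

open Set MeasureTheory MvPolynomial
open scoped BigOperators
open Literature.NumberTheory.Transcendental
open Literature.ModelTheory.ExponentialFields (IsSemialgebraic)

namespace Summit.KontsevichZagierPeriods.Theorems.HurwitzMicroSectorsHurwitzSectorComplement

namespace ClausenCells

/-! ### Cells, null walls, and the packaged rule-(2) move -/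

/-- The cell `{P > 0}`, `P = (1 − v²) − (1 + v²)x`, is `ℚ`-semialgebraic. [folklore] -/
theorem sa_pos : IsSemialgebraic ℚ {y : Fin 2 → ℝ | 0 < (1 - y 1 ^ 2) - (1 + y 1 ^ 2) * y 0} := by
  convert Literature.ModelTheory.ExponentialFields.isSemialgebraic_setOf_eval_pos (k := ℚ) (R := ℝ)
    ((1 - X 1 ^ 2) - (1 + X 1 ^ 2) * X 0 : MvPolynomial (Fin 2) ℚ) using 1
  ext y
  simp

/-- The cell `{P < 0}` is `ℚ`-semialgebraic. [folklore] -/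
theorem sa_neg : IsSemialgebraic ℚ {y : Fin 2 → ℝ | (1 - y 1 ^ 2) - (1 + y 1 ^ 2) * y 0 < 0} := by
  convert Literature.ModelTheory.ExponentialFields.isSemialgebraic_setOf_eval_pos (k := ℚ) (R := ℝ)
    ((1 + X 1 ^ 2) * X 0 - (1 - X 1 ^ 2) : MvPolynomial (Fin 2) ℚ) using 1
  ext y
  simp [sub_pos, sub_neg]

/-- The real zero set of a polynomial over `ℚ` in two variables which does not vanish at some
point is Lebesgue-null. [folklore] -/
theorem volume_zeroSet {p : MvPolynomial (Fin 2) ℚ} (x : Fin 2 → ℝ) (hx : aeval x p ≠ 0) :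
    volume {y : Fin 2 → ℝ | aeval y p = 0} = 0 :=
  volume_setOf_aeval_eq_zero p fun h0 => hx (by
    rw [MvPolynomial.aeval_def, ← MvPolynomial.eval_map, h0, map_zero])

/-- The curve `{P = 0}` (`x = c(v)`) separating the two cells of a set `S` is null:
`S ∖ ((S ∩ {P > 0}) ∪ (S ∩ {P < 0}))` has volume `0`. [folklore] -/
theorem volume_diff_cells (S : Set (Fin 2 → ℝ)) :
    volume (S \ ((S ∩ {y | 0 < (1 - y 1 ^ 2) - (1 + y 1 ^ 2) * y 0}) ∪
      (S ∩ {y | (1 - y 1 ^ 2) - (1 + y 1 ^ 2) * y 0 < 0}))) = 0 := by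
  refine measure_mono_null (fun y hy => ?_)
    (volume_zeroSet (p := (1 - X 1 ^ 2) - (1 + X 1 ^ 2) * X 0) 0 (by simp))
  obtain ⟨hyS, hn⟩ := hy
  simp only [mem_union, mem_inter_iff, mem_setOf_eq, not_or, not_and, not_lt] at hn
  have h1 := hn.1 hyS
  have h2 := hn.2 hyS
  simp only [mem_setOf_eq, map_sub, map_mul, map_add, map_one, map_pow, aeval_X]
  linarith

/-- `4v² < u(1+v²)²` forces `u > 0`. [folklore] -/
theorem pos_of_lt {v u : ℝ} (h : 4 * v ^ 2 < u * (1 + v ^ 2) ^ 2) : 0 < u := by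
  by_contra hu
  rw [not_lt] at hu
  have := mul_nonpos_of_nonpos_of_nonneg hu (sq_nonneg (1 + v ^ 2))
  nlinarith [sq_nonneg v]

/-- The integrand `1/((1+v²)u)` is `ℚ`-semialgebraic on any `ℚ`-semialgebraic set where `u > 0`
(a quotient of polynomials with non-vanishing denominator). [folklore] -/
theorem sa_recip {E : Set (Fin 2 → ℝ)} (hE : IsSemialgebraic ℚ E) (hpos : ∀ w ∈ E, 0 < w 1) :
    IsSemialgebraicFunOn ℚ E (fun w => 1 / ((1 + w 0 ^ 2) * w 1)) := by
  refine (isSemialgebraicFunOn_aeval_div_aeval hE 1 ((1 + X 0 ^ 2) * X 1) fun w hw => ?_).congr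
    fun w _ => by simp
  have := hpos w hw
  simp only [map_mul, map_add, map_one, map_pow, aeval_X]
  positivity

/-- **Rule (2), packaged.** If `Ψ` (differentiable with Jacobian field `Ψ'`, `ℚ`-semialgebraic on
`ℚ`-semialgebraic sets) is injective on `r.domain`, `g` is `ℚ`-semialgebraic on the image `E`, and
`r.integrand = g ∘ Ψ · |det Ψ'|` on `r.domain`, then `[E, g]` IS an integral representation (its
domain is semialgebraic as the image of a semialgebraic map, Tarski–Seidenberg; its integrability is
transported through `Ψ`, `MeasureTheory.integrableOn_image_iff_integrableOn_abs_det_fderiv_smul`)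
and `[r] − [E, g] ∈ changeOfVariablesRel`. [cite: KontsevichZagier2001, §1.2 rule (2)] -/
theorem exists_cov {Ψ : (Fin 2 → ℝ) → Fin 2 → ℝ} {Ψ' : (Fin 2 → ℝ) → (Fin 2 → ℝ) →L[ℝ] (Fin 2 → ℝ)}
    (hd : ∀ y, HasFDerivAt Ψ (Ψ' y) y)
    (hsa : ∀ s : Set (Fin 2 → ℝ), IsSemialgebraic ℚ s → IsSemialgebraicMapOn ℚ s Ψ)
    (r : KZ.IntegralRep 2) (hinj : InjOn Ψ r.domain) {E : Set (Fin 2 → ℝ)}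
    (himage : Ψ '' r.domain = E) {g : (Fin 2 → ℝ) → ℝ} (hg : IsSemialgebraicFunOn ℚ E g)
    (hpull : ∀ y ∈ r.domain, r.integrand y = g (Ψ y) * |(Ψ' y).det|) :
    ∃ e : KZ.IntegralRep 2, e.domain = E ∧ e.integrand = g ∧
      KZ.of r - KZ.of e ∈ KZ.changeOfVariablesRel := by
  have hmeas : MeasurableSet r.domain := KZ.IntegralRep.measurableSet_domain_holds r
  have hderiv : ∀ y ∈ r.domain, HasFDerivWithinAt Ψ (Ψ' y) r.domain y := fun y _ =>
    (hd y).hasFDerivWithinAt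
  have hE : IsSemialgebraic ℚ E := by
    rw [← himage]
    exact IsSemialgebraicMapOn.isSemialgebraic_image_holds (hsa _ r.isSemialgebraic_domain)
      subset_rfl r.isSemialgebraic_domain
  have hint : IntegrableOn g E volume := by
    rw [← himage]
    refine (integrableOn_image_iff_integrableOn_abs_det_fderiv_smul volume hmeas hderiv hinj g).mpr ?_
    refine r.integrableOn.congr_fun (fun y hy => ?_) hmeas
    rw [hpull y hy, smul_eq_mul, mul_comm]
  exact ⟨⟨E, g, hE, hg, hint⟩, rfl, rfl, 2, r, ⟨E, g, hE, hg, hint⟩, Ψ, Ψ',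
    hsa _ r.isSemialgebraic_domain, hderiv, hinj, himage.symm, hpull, rfl⟩

end ClausenCells

open ClausenCells in
/-- **Auxiliary stub 2 of S5 (split and substitute).** For `q = [(0,1)², g(v)T(v;x)]` (domain and
integrand fixed by hypotheses) there are representations `e₁ = [E₁, 1/((1+v²)u)]`,
`e₂ = [E₂, −1/((1+v²)u)]` with `[q] − [e₁] − [e₂] ∈ KZ.relations`: split `q` along the null
curve `x = c(v)` (rule (1): `KZ.IntegralRep.of_sub_of_restrict_mem_relations` + one domain
additivity) and move each cell by the chart of `stub_clausenCells_aux1` (rule (2), twice).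
[cite: KontsevichZagier2001, §1.2 rules (1), (2)] -/
theorem stub_clausenCells_aux2 : ∀ (q : KZ.IntegralRep 2), q.domain = {y | y 0 ∈ Set.Ioo (0:ℝ) 1 ∧ y 1 ∈ Set.Ioo (0:ℝ) 1} → Set.EqOn q.integrand (fun y => 2 / (1 + y 1 ^ 2) * (((1 - y 1 ^ 2) - (1 + y 1 ^ 2) * y 0) / ((1 - y 0) ^ 2 + y 1 ^ 2 * (1 + y 0) ^ 2))) q.domain → ∃ (e₁ e₂ : KZ.IntegralRep 2), e₁.domain = {w | 0 < w 0 ∧ w 0 < 1 ∧ 4 * w 0 ^ 2 < w 1 * (1 + w 0 ^ 2) ^ 2 ∧ w 1 < 1} ∧ e₁.integrand = (fun w => 1 / ((1 + w 0 ^ 2) * w 1)) ∧ e₂.domain = {w | 0 < w 0 ∧ w 0 < 1 ∧ 4 * w 0 ^ 2 < w 1 * (1 + w 0 ^ 2) ^ 2 ∧ w 1 * (1 + w 0 ^ 2) < 4 * w 0 ^ 2} ∧ e₂.integrand = (fun w => -(1 / ((1 + w 0 ^ 2) * w 1))) ∧ KZ.of q - KZ.of e₁ - KZ.of e₂ ∈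 KZ.relations := by
  intro q hqd hqi
  obtain ⟨Ψ, Ψ', hd, hsa, hinjm, hinjp, himm, himp, hpm, hpp⟩ := stub_clausenCells_aux1
  -- Step 1: split `q` along the null curve `x = c(v)` (rule (1))
  set S : Set (Fin 2 → ℝ) := {y : Fin 2 → ℝ | y 0 ∈ Set.Ioo (0:ℝ) 1 ∧ y 1 ∈ Set.Ioo (0:ℝ) 1}
    with hS_def
  set Xm : Set (Fin 2 → ℝ) := S ∩ {y | 0 < (1 - y 1 ^ 2) - (1 + y 1 ^ 2) * y 0} with hXm_def
  set Xp : Set (Fin 2 → ℝ) := S ∩ {y | (1 - y 1 ^ 2) - (1 + y 1 ^ 2) * y 0 < 0} with hXp_def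
  have hS : IsSemialgebraic ℚ S := by rw [← hqd]; exact q.isSemialgebraic_domain
  have hXm : IsSemialgebraic ℚ Xm := hS.inter sa_pos
  have hXp : IsSemialgebraic ℚ Xp := hS.inter sa_neg
  have hXmS : Xm ⊆ q.domain := by rw [hqd]; exact inter_subset_left
  have hXpS : Xp ⊆ q.domain := by rw [hqd]; exact inter_subset_left
  have hU : IsSemialgebraic ℚ (Xm ∪ Xp) := hXm.union hXp
  have hUS : Xm ∪ Xp ⊆ q.domain := union_subset hXmS hXpS
  set qm := q.restrict Xm hXm hXmS with hqm
  set qp := q.restrict Xp hXp hXpS with hqp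
  have step1 : KZ.of q - KZ.of qm - KZ.of qp ∈ KZ.relations := by
    have h1 : KZ.of q - KZ.of (q.restrict _ hU hUS) ∈ KZ.relations :=
      q.of_sub_of_restrict_mem_relations hU hUS (by rw [hqd]; exact volume_diff_cells S)
    have h0 : Xm ∩ Xp = ∅ :=
      eq_empty_of_forall_notMem fun y ⟨⟨_, h⟩, ⟨_, h'⟩⟩ => lt_asymm (α := ℝ) h h'
    have h2 : KZ.of (q.restrict _ hU hUS) - KZ.of qm - KZ.of qp ∈ KZ.relations :=
      KZ.domainAddRel_subset_relations ⟨2, q.restrict _ hU hUS, qm, qp, rfl, by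
        change volume (Xm ∩ Xp) = 0
        rw [h0, measure_empty], fun _ _ => rfl, fun _ _ => rfl, rfl⟩
    have : KZ.of q - KZ.of qm - KZ.of qp = (KZ.of q - KZ.of (q.restrict _ hU hUS)) +
        (KZ.of (q.restrict _ hU hUS) - KZ.of qm - KZ.of qp) := by abel
    rw [this]
    exact add_mem h1 h2
  -- Steps 2, 3: the two changes of variables (rule (2))
  have hE₁ : IsSemialgebraic ℚ
      {w : Fin 2 → ℝ | 0 < w 0 ∧ w 0 < 1 ∧ 4 * w 0 ^ 2 < w 1 * (1 + w 0 ^ 2) ^ 2 ∧ w 1 < 1} := by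
    rw [← himm]
    exact IsSemialgebraicMapOn.isSemialgebraic_image_holds (hsa _ hXm) subset_rfl hXm
  have hE₂ : IsSemialgebraic ℚ {w : Fin 2 → ℝ | 0 < w 0 ∧ w 0 < 1 ∧
      4 * w 0 ^ 2 < w 1 * (1 + w 0 ^ 2) ^ 2 ∧ w 1 * (1 + w 0 ^ 2) < 4 * w 0 ^ 2} := by
    rw [← himp]
    exact IsSemialgebraicMapOn.isSemialgebraic_image_holds (hsa _ hXp) subset_rfl hXp
  have hg₁ := sa_recip hE₁ fun w hw => pos_of_lt hw.2.2.1
  have hg₂ := (sa_recip hE₂ fun w hw => pos_of_lt hw.2.2.1).neg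
  obtain ⟨e₁, h₁d, h₁i, hcov₁⟩ := exists_cov hd hsa qm (hinjm.mono inter_subset_right) himm hg₁
    fun y hy => (hqi (hXmS hy)).trans (hpm y hy)
  obtain ⟨e₂, h₂d, h₂i, hcov₂⟩ := exists_cov hd hsa qp (hinjp.mono inter_subset_right) himp hg₂
    fun y hy => (hqi (hXpS hy)).trans (hpp y hy)
  refine ⟨e₁, e₂, h₁d, h₁i, h₂d, h₂i, ?_⟩
  have : KZ.of q - KZ.of e₁ - KZ.of e₂ =
      (KZ.of q - KZ.of qm - KZ.of qp) + (KZ.of qm - KZ.of e₁) + (KZ.of qp - KZ.of e₂) := by abel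
  rw [this]
  exact add_mem (add_mem step1 (KZ.changeOfVariablesRel_subset_relations hcov₁))
    (KZ.changeOfVariablesRel_subset_relations hcov₂)

namespace ClausenCells

/-! ### Cancellation of the doubly covered `u`-range -/

/-- `E₁` minus its two pieces `A = E₁ ∩ E₂` and `pPlus.domain` lies in the graph
`{u(1+v²) = 4v²}`, a null set. [folklore] -/
theorem volume_E1_diff :
    volume ({w : Fin 2 → ℝ | 0 < w 0 ∧ w 0 < 1 ∧ 4 * w 0 ^ 2 < w 1 * (1 + w 0 ^ 2) ^ 2 ∧ w 1 < 1} \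
      (({w : Fin 2 → ℝ | 0 < w 0 ∧ w 0 < 1 ∧ 4 * w 0 ^ 2 < w 1 * (1 + w 0 ^ 2) ^ 2 ∧ w 1 < 1} ∩
          {w : Fin 2 → ℝ | 0 < w 0 ∧ w 0 < 1 ∧ 4 * w 0 ^ 2 < w 1 * (1 + w 0 ^ 2) ^ 2 ∧
            w 1 * (1 + w 0 ^ 2) < 4 * w 0 ^ 2}) ∪
        {v : Fin 2 → ℝ | 0 < v 0 ∧ v 0 < 1 ∧ 4 * v 0 ^ 2 / (1 + v 0 ^ 2) < v 1 ∧ v 1 < 1})) = 0 := by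
  refine measure_mono_null (fun w hw => ?_)
    (volume_zeroSet (p := X 1 * (1 + X 0 ^ 2) - 4 * X 0 ^ 2) ![0, 1] (by simp))
  obtain ⟨⟨hv0, hv1, hm, hu1⟩, hn⟩ := hw
  simp only [mem_union, mem_inter_iff, mem_setOf_eq, not_or] at hn
  obtain ⟨hnA, hnP⟩ := hn
  have hp : (0:ℝ) < 1 + w 0 ^ 2 := by positivity
  have h1 : ¬ (w 1 * (1 + w 0 ^ 2) < 4 * w 0 ^ 2) := fun h =>
    hnA ⟨⟨hv0, hv1, hm, hu1⟩, ⟨hv0, hv1, hm, h⟩⟩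
  have h2 : ¬ (4 * w 0 ^ 2 / (1 + w 0 ^ 2) < w 1) := fun h => hnP ⟨hv0, hv1, h, hu1⟩
  rw [div_lt_iff₀ hp, not_lt] at h2
  rw [not_lt] at h1
  simp only [mem_setOf_eq, map_sub, map_mul, map_add, map_one, map_pow, aeval_X, map_ofNat]
  linarith

/-- `E₂` minus its two pieces `A = E₁ ∩ E₂` and `pMinus.domain` lies in the line `{u = 1}`, a null
set. [folklore] -/
theorem volume_E2_diff :
    volume ({w : Fin 2 → ℝ | 0 < w 0 ∧ w 0 < 1 ∧ 4 * w 0 ^ 2 < w 1 * (1 + w 0 ^ 2) ^ 2 ∧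
        w 1 * (1 + w 0 ^ 2) < 4 * w 0 ^ 2} \
      (({w : Fin 2 → ℝ | 0 < w 0 ∧ w 0 < 1 ∧ 4 * w 0 ^ 2 < w 1 * (1 + w 0 ^ 2) ^ 2 ∧ w 1 < 1} ∩
          {w : Fin 2 → ℝ | 0 < w 0 ∧ w 0 < 1 ∧ 4 * w 0 ^ 2 < w 1 * (1 + w 0 ^ 2) ^ 2 ∧
            w 1 * (1 + w 0 ^ 2) < 4 * w 0 ^ 2}) ∪
        {v : Fin 2 → ℝ | 0 < v 0 ∧ v 0 < 1 ∧ 1 < v 1 ∧ v 1 < 4 * v 0 ^ 2 / (1 + v 0 ^ 2)})) = 0 := by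
  refine measure_mono_null (fun w hw => ?_) (volume_zeroSet (p := X 1 - 1) 0 (by simp))
  obtain ⟨⟨hv0, hv1, hm, hM⟩, hn⟩ := hw
  simp only [mem_union, mem_inter_iff, mem_setOf_eq, not_or] at hn
  obtain ⟨hnA, hnQ⟩ := hn
  have hp : (0:ℝ) < 1 + w 0 ^ 2 := by positivity
  have h1 : ¬ (w 1 < 1) := fun h => hnA ⟨⟨hv0, hv1, hm, h⟩, ⟨hv0, hv1, hm, hM⟩⟩
  have h2 : ¬ (1 < w 1) := fun h => hnQ ⟨hv0, hv1, h, by rwa [lt_div_iff₀ hp]⟩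
  rw [not_lt] at h1 h2
  simp only [mem_setOf_eq, map_sub, map_one, aeval_X]
  linarith

/-- **Cancellation.** With `A = E₁ ∩ E₂`, `E₁ = A ∪ pPlus.domain ∪ (null)`,
`E₂ = A ∪ pMinus.domain ∪ (null)` (disjoint pieces), `[E₁, f] + [E₂, −f] ≡ [pPlus] − [pMinus]`:
two domain additivities, two null walls, and `[A, f] + [A, −f] ≡ 0`, `[pMinus.domain, −f] + [pMinus] ≡ 0`
(integrand additivity with a zero integrand). [cite: KontsevichZagier2001, §1.2 rule (1)] -/
theorem cancel (e₁ e₂ pPlus pMinus : KZ.IntegralRep 2)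
    (h₁d : e₁.domain = {w | 0 < w 0 ∧ w 0 < 1 ∧ 4 * w 0 ^ 2 < w 1 * (1 + w 0 ^ 2) ^ 2 ∧ w 1 < 1})
    (h₁i : e₁.integrand = fun w => 1 / ((1 + w 0 ^ 2) * w 1))
    (h₂d : e₂.domain = {w | 0 < w 0 ∧ w 0 < 1 ∧ 4 * w 0 ^ 2 < w 1 * (1 + w 0 ^ 2) ^ 2 ∧
      w 1 * (1 + w 0 ^ 2) < 4 * w 0 ^ 2})
    (h₂i : e₂.integrand = fun w => -(1 / ((1 + w 0 ^ 2) * w 1)))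
    (hPd : pPlus.domain = {v | 0 < v 0 ∧ v 0 < 1 ∧ 4 * v 0 ^ 2 / (1 + v 0 ^ 2) < v 1 ∧ v 1 < 1})
    (hPi : EqOn pPlus.integrand (fun v => 1 / ((1 + v 0 ^ 2) * v 1)) pPlus.domain)
    (hMd : pMinus.domain = {v | 0 < v 0 ∧ v 0 < 1 ∧ 1 < v 1 ∧ v 1 < 4 * v 0 ^ 2 / (1 + v 0 ^ 2)})
    (hMi : EqOn pMinus.integrand (fun v => 1 / ((1 + v 0 ^ 2) * v 1)) pMinus.domain) :
    KZ.of e₁ + KZ.of e₂ - KZ.of pPlus + KZ.of pMinus ∈ KZ.relations := by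
  -- the pieces (`A = E₁ ∩ E₂`, written with the domains of `e₁`, `e₂`)
  set P : Set (Fin 2 → ℝ) := {v : Fin 2 → ℝ | 0 < v 0 ∧ v 0 < 1 ∧ 4 * v 0 ^ 2 / (1 + v 0 ^ 2) < v 1 ∧
    v 1 < 1} with hP_def
  set Q : Set (Fin 2 → ℝ) := {v : Fin 2 → ℝ | 0 < v 0 ∧ v 0 < 1 ∧ 1 < v 1 ∧
    v 1 < 4 * v 0 ^ 2 / (1 + v 0 ^ 2)} with hQ_def
  have hA : IsSemialgebraic ℚ (e₁.domain ∩ e₂.domain) :=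
    e₁.isSemialgebraic_domain.inter e₂.isSemialgebraic_domain
  have hP : IsSemialgebraic ℚ P := by rw [← hPd]; exact pPlus.isSemialgebraic_domain
  have hQ : IsSemialgebraic ℚ Q := by rw [← hMd]; exact pMinus.isSemialgebraic_domain
  -- `P ⊆ E₁`, `Q ⊆ E₂`, disjoint from `A`
  have hPsub : P ⊆ e₁.domain := by
    rw [h₁d]
    rintro w ⟨hv0, hv1, hM, hu1⟩
    have hp : (0:ℝ) < 1 + w 0 ^ 2 := by positivity
    rw [div_lt_iff₀ hp] at hM
    have hu : 0 < w 1 := by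
      by_contra h
      rw [not_lt] at h
      linarith [mul_nonpos_of_nonpos_of_nonneg h hp.le, sq_nonneg (w 0)]
    refine ⟨hv0, hv1, ?_, hu1⟩
    nlinarith [mul_nonneg (mul_pos hu hp).le (sq_nonneg (w 0))]
  have hQsub : Q ⊆ e₂.domain := by
    rw [h₂d]
    rintro w ⟨hv0, hv1, h1u, hM⟩
    have hp : (0:ℝ) < 1 + w 0 ^ 2 := by positivity
    rw [lt_div_iff₀ hp] at hM
    refine ⟨hv0, hv1, ?_, hM⟩
    nlinarith [mul_pos (sub_pos.2 h1u) (pow_pos hp 2), sq_nonneg (1 - w 0 ^ 2)]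
  have hAPsub : e₁.domain ∩ e₂.domain ∪ P ⊆ e₁.domain :=
    union_subset inter_subset_left hPsub
  have hAQsub : e₁.domain ∩ e₂.domain ∪ Q ⊆ e₂.domain :=
    union_subset inter_subset_right hQsub
  have hAP0 : e₁.domain ∩ e₂.domain ∩ P = ∅ := by
    rw [h₁d, h₂d]
    refine eq_empty_of_forall_notMem fun w ⟨⟨_, ⟨_, _, _, hlt⟩⟩, ⟨_, _, hgt, _⟩⟩ => ?_
    have hp : (0:ℝ) < 1 + w 0 ^ 2 := by positivity
    rw [div_lt_iff₀ hp] at hgt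
    linarith
  have hAQ0 : e₁.domain ∩ e₂.domain ∩ Q = ∅ := by
    rw [h₁d, h₂d]
    exact eq_empty_of_forall_notMem fun w ⟨⟨⟨_, _, _, hlt⟩, _⟩, ⟨_, _, hgt, _⟩⟩ => lt_asymm hlt hgt
  -- restrictions
  set e₁AP := e₁.restrict _ (hA.union hP) hAPsub with he₁AP
  set e₁A := e₁.restrict _ hA inter_subset_left with he₁A
  set e₁P := e₁.restrict P hP hPsub with he₁P
  set e₂AQ := e₂.restrict _ (hA.union hQ) hAQsub with he₂AQ
  set e₂A := e₂.restrict _ hA inter_subset_right with he₂A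
  set e₂Q := e₂.restrict Q hQ hQsub with he₂Q
  -- the seven relations
  have s1 : KZ.of e₁ - KZ.of e₁AP ∈ KZ.relations :=
    e₁.of_sub_of_restrict_mem_relations (hA.union hP) hAPsub (by
      rw [h₁d, h₂d]
      exact volume_E1_diff)
  have s2 : KZ.of e₁AP - KZ.of e₁A - KZ.of e₁P ∈ KZ.relations :=
    KZ.domainAddRel_subset_relations ⟨2, e₁AP, e₁A, e₁P, rfl, by
      change volume (e₁.domain ∩ e₂.domain ∩ P) = 0
      rw [hAP0, measure_empty], fun _ _ => rfl, fun _ _ => rfl, rfl⟩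
  have s3 : KZ.of e₁P - KZ.of pPlus ∈ KZ.relations :=
    KZ.of_sub_of_mem_relations_of_eqOn hPd fun w hw => by
      have hw' : w ∈ pPlus.domain := by rw [hPd]; exact hw
      change e₁.integrand w = pPlus.integrand w
      rw [h₁i, hPi hw']
  have s4 : KZ.of e₂ - KZ.of e₂AQ ∈ KZ.relations :=
    e₂.of_sub_of_restrict_mem_relations (hA.union hQ) hAQsub (by
      rw [h₁d, h₂d]
      exact volume_E2_diff)
  have s5 : KZ.of e₂AQ - KZ.of e₂A - KZ.of e₂Q ∈ KZ.relations :=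
    KZ.domainAddRel_subset_relations ⟨2, e₂AQ, e₂A, e₂Q, rfl, by
      change volume (e₁.domain ∩ e₂.domain ∩ Q) = 0
      rw [hAQ0, measure_empty], fun _ _ => rfl, fun _ _ => rfl, rfl⟩
  have s6 : KZ.of e₂Q + KZ.of pMinus ∈ KZ.relations :=
    KZ.of_add_of_mem_relations_of_eqOn_neg hMd fun w hw => by
      have hw' : w ∈ pMinus.domain := by rw [hMd]; exact hw
      change pMinus.integrand w = -(e₂.integrand w)
      rw [h₂i]
      simp only [neg_neg]
      exact hMi hw'
  have s7 : KZ.of e₁A + KZ.of e₂A ∈ KZ.relations :=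
    KZ.of_add_of_mem_relations_of_eqOn_neg rfl fun w _ => by
      change e₂.integrand w = -(e₁.integrand w)
      rw [h₁i, h₂i]
  have : KZ.of e₁ + KZ.of e₂ - KZ.of pPlus + KZ.of pMinus =
      (KZ.of e₁ - KZ.of e₁AP) + (KZ.of e₁AP - KZ.of e₁A - KZ.of e₁P) + (KZ.of e₁P - KZ.of pPlus) +
      (KZ.of e₂ - KZ.of e₂AQ) + (KZ.of e₂AQ - KZ.of e₂A - KZ.of e₂Q) + (KZ.of e₂Q + KZ.of pMinus) +
      (KZ.of e₁A + KZ.of e₂A) := by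
    abel
  rw [this]
  exact add_mem (add_mem (add_mem (add_mem (add_mem (add_mem s1 s2) s3) s4) s5) s6) s7

end ClausenCells

open ClausenCells in
/-- **S5 (the Catalan–Clausen junction, cells below the U-step).** The logarithmic bottom
`q = [(0,1)², g(v)·T(v;x)]` is congruent modulo the Kontsevich–Zagier moves to `[p₊] − [p₋]`, the
two cells of the unfolded Clausen arc in the coordinates `v = tan(φ/2)`, `u = x² − 2c(v)x + 1`,
`c(v) = (1−v²)/(1+v²)`: split `q` at the null curve `x = c(v)` (rule (1)); on each cell the fibrewise
substitution `Ψ(x,v) = (v,u)` is ONE change of variables (rule (2), `g T dx = −du/((1+v²)u)`), onto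
`[E₁, 1/((1+v²)u)]` and `[E₂, −1/((1+v²)u)]` (`stub_clausenCells_aux2`); the doubly covered range
`A = E₁ ∩ E₂ = {m(v) < u < min(M(v),1)}` cancels and the remainders are `p₊.domain` and
`p₋.domain` up to null walls (rule (1), `ClausenCells.cancel`).
[cite: KontsevichZagier2001, §1.2 rules (1), (2)] -/
theorem stub_clausenCells : ∀ (q pPlus pMinus : KZ.IntegralRep 2), q.domain = {y | y 0 ∈ Set.Ioo (0:ℝ) 1 ∧ y 1 ∈ Set.Ioo (0:ℝ) 1} → Set.EqOn q.integrand (fun y => 2 / (1 + y 1 ^ 2) * (((1 - y 1 ^ 2) - (1 + y 1 ^ 2) * y 0) / ((1 - y 0) ^ 2 + y 1 ^ 2 * (1 + y 0) ^ 2))) q.domain → pPlus.domain = {v | 0 < v 0 ∧ v 0 < 1 ∧ 4 * v 0 ^ 2 / (1 + v 0 ^ 2) < v 1 ∧ v 1 < 1} → Set.EqOn pPlus.integrand (fun v => 1 / ((1 + v 0 ^ 2) * v 1)) pPlus.domain → pMinus.domain = {v | 0 < v 0 ∧ v 0 < 1 ∧ 1 < v 1 ∧ v 1 < 4 * v 0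 ^ 2 / (1 + v 0 ^ 2)} → Set.EqOn pMinus.integrand (fun v => 1 / ((1 + v 0 ^ 2) * v 1)) pMinus.domain → KZ.of q - KZ.of pPlus + KZ.of pMinus ∈ KZ.relations := by
  intro q pPlus pMinus hqd hqi hPd hPi hMd hMi
  obtain ⟨e₁, e₂, h₁d, h₁i, h₂d, h₂i, hq⟩ := stub_clausenCells_aux2 q hqd hqi
  have hc := cancel e₁ e₂ pPlus pMinus h₁d h₁i h₂d h₂i hPd hPi hMd hMi
  have : KZ.of q - KZ.of pPlus + KZ.of pMinus =
      (KZ.of q - KZ.of e₁ - KZ.of e₂) + (KZ.of e₁ + KZ.of e₂ - KZ.of pPlus + KZ.of pMinus) := by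
    abel
  rw [this]
  exact add_mem hq hc

end Summit.KontsevichZagierPeriods.Theorems.HurwitzMicroSectorsHurwitzSectorComplement

end
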